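import Summits.Schanuel.Schanuel.Theorems.ZilberEacNewtonPolygonBezout
import Mathlib.Algebra.Polynomial.Taylor
import HarnessLib

/-!
# The equimodular class, LXX: one step of the Newton–Puiseux induction — roots of the edge
# polynomial, the re-centred polynomial, the totally degenerate edge, and the translation

HONEST FRAMING.  Cell `pub-schanuel` (Zilber's Exponential-Algebraic Closedness, case ladder;
host summit Schanuel), seat 2, gen 26.  Third brick of the Newton–Puiseux existence theorem (file
LXXI).  With `E` the first edge polynomial of `F` at the origin (file LXVIII):
* **`firstEdge_coeff`** — the coefficient formula of `E`;
* **`exists_root_firstEdge`** — `E` has a NONZERO root `w₀`, of multiplicity `1 ≤ m₁ ≤ m`;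
* **`recentre_facts`** — for `G` with `G(0, ·) = E`, the re-centred `G̃(t, w) = G(t, w₀ + w)` has
  `G̃(0, ·)` with the root `0` of multiplicity exactly `m₁` (rows `< m₁` vanish at `0`, row `m₁` not);
* **`degenerate_edge`** — if `m₁ = m = deg E` then `E = c (X - w₀)^m`, so `E.coeff (m-1) ≠ 0` and
  `E.coeff 0 ≠ 0`: the edge has integer slope `λ₀ = ord₀ f_{m-1}` (`μ = k λ₀`), `ord₀ f₀ = λ₀ m`,
  and `(1, λ₀)` is again an edge datum with the same edge polynomial;
* **`translate_facts`** — for `F₁(x, y) = F(x, y + w₀ x^{λ₀})`: `F₁(0, ·) = F(0, ·)` and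
  `F₁(t, 0) = F(t, w₀ t^{λ₀})`.
[folklore (Newton–Puiseux), made concrete]; nothing here is specific to Schanuel's conjecture
(neither used nor implied); Mantova–Masser's question (PLMS 2024 §1 p. 5) and EC(3,2) stay OPEN.
-/

noncomputable section

open Polynomial

set_option linter.dupNamespace false

namespace Summit.Schanuel.Schanuel.Theorems

/-! ## Part A. The edge polynomial: coefficients and a nonzero root -/

/-- The coefficient formula of the first edge polynomial. [folklore] -/
theorem firstEdge_coeff (F : ℂ[X][X]) (k μ ν : ℕ) (j : ℕ) :
    (∑ i ∈ (Finset.range (F.natDegree + 1)).filter (fun i => F.coeff i ≠ 0 ∧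
        k * Polynomial.rootMultiplicity 0 (F.coeff i) + μ * i = ν),
        Polynomial.C ((F.coeff i /ₘ (Polynomial.X - Polynomial.C 0) ^
          Polynomial.rootMultiplicity 0 (F.coeff i)).eval 0) * Polynomial.X ^ i).coeff j =
      if (j < F.natDegree + 1 ∧ (F.coeff j ≠ 0 ∧ k * Polynomial.rootMultiplicity 0 (F.coeff j) + μ * j = ν))
      then (F.coeff j /ₘ (Polynomial.X - Polynomial.C 0) ^ Polynomial.rootMultiplicity 0 (F.coeff j)).eval 0
      else 0 := by
  classical
  simp only [Polynomial.finsetSum_coeff, Polynomial.coeff_C_mul_X_pow]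
  rw [Finset.sum_ite_eq]
  simp only [Finset.mem_filter, Finset.mem_range]

/-- **A nonzero root of the edge polynomial.**  `E ≠ 0` of degree `m` with a nonzero coefficient in
degree `j₁ < m` has a root `w₀ ≠ 0`, of multiplicity `m₁` with `1 ≤ m₁ ≤ m`. [folklore] -/
theorem exists_root_firstEdge {E : ℂ[X]} {m j₁ : ℕ} (hE0 : E ≠ 0) (hdeg : E.natDegree = m)
    (hj₁ : j₁ < m) (hEj₁ : E.coeff j₁ ≠ 0) :
    ∃ w₀ : ℂ, w₀ ≠ 0 ∧ E.IsRoot w₀ ∧ 1 ≤ Polynomial.rootMultiplicity w₀ E ∧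
      Polynomial.rootMultiplicity w₀ E ≤ m := by
  set n₀ := Polynomial.rootMultiplicity 0 E with hn₀
  have hn₀le : n₀ ≤ j₁ := by
    rw [hn₀, Polynomial.rootMultiplicity_eq_natTrailingDegree']
    exact Polynomial.natTrailingDegree_le_of_ne_zero hEj₁
  set E₁ := E /ₘ (Polynomial.X - Polynomial.C 0) ^ n₀ with hE₁
  have hfac : (Polynomial.X - Polynomial.C 0) ^ n₀ * E₁ = E :=
    Polynomial.pow_mul_divByMonic_rootMultiplicity_eq E 0
  have hE₁0 : E₁.eval 0 ≠ 0 := Polynomial.eval_divByMonic_pow_rootMultiplicity_ne_zero 0 hE0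
  have hE₁deg : E₁.natDegree = m - n₀ := by
    rw [hE₁, Polynomial.natDegree_divByMonic _ ((Polynomial.monic_X_sub_C 0).pow n₀), hdeg,
      Polynomial.natDegree_pow, Polynomial.natDegree_X_sub_C, mul_one]
  have hE₁ne : E₁ ≠ 0 := fun h => hE₁0 (by rw [h, Polynomial.eval_zero])
  have hE₁deg' : 0 < E₁.degree := by
    rw [Polynomial.degree_eq_natDegree hE₁ne, hE₁deg]
    exact_mod_cast (by omega : 0 < m - n₀)
  obtain ⟨w₀, hw₀⟩ := Complex.exists_root hE₁deg'
  have hw₀0 : w₀ ≠ 0 := by rintro rfl; exact hE₁0 hw₀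
  have hEw₀ : E.IsRoot w₀ := by
    rw [Polynomial.IsRoot, ← hfac, Polynomial.eval_mul, hw₀.eq_zero, mul_zero]
  refine ⟨w₀, hw₀0, hEw₀, (Polynomial.rootMultiplicity_pos hE0).2 hEw₀, ?_⟩
  have hdvd := Polynomial.pow_rootMultiplicity_dvd E w₀
  have h := Polynomial.natDegree_le_of_dvd hdvd hE0
  rwa [Polynomial.natDegree_pow, Polynomial.natDegree_X_sub_C, mul_one, hdeg] at h

/-! ## Part B. Re-centring `G` at a root of `G(0, ·)` -/

/-- Evaluation of the re-centred polynomial: `G̃(t, w) = G(t, w₀ + w)`. [folklore] -/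
theorem evalPP_comp_X_add_C (G : ℂ[X][X]) (q : ℂ[X]) (t w : ℂ) :
    ((G.comp (Polynomial.X + Polynomial.C q)).map (Polynomial.evalRingHom t)).eval w =
      (G.map (Polynomial.evalRingHom t)).eval (w + q.eval t) := by
  rw [Polynomial.map_comp, Polynomial.eval_comp]
  simp

/-- **The re-centred polynomial.**  If `G(0, ·) = E ≠ 0` and `m₁ = mult_{w₀} E`, then the rows of
`G̃ = G(t, w₀ + w)` vanish at `t = 0` in degrees `< m₁` and row `m₁` does not. [folklore] -/
theorem recentre_facts {G : ℂ[X][X]} {E : ℂ[X]} (hG0 : G.map (Polynomial.evalRingHom 0) = E)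
    (hE0 : E ≠ 0) (w₀ : ℂ) :
    (∀ j, j < Polynomial.rootMultiplicity w₀ E →
      ((G.comp (Polynomial.X + Polynomial.C (Polynomial.C w₀))).coeff j).IsRoot 0) ∧
    ¬ ((G.comp (Polynomial.X + Polynomial.C (Polynomial.C w₀))).coeff
      (Polynomial.rootMultiplicity w₀ E)).IsRoot 0 := by
  set Gs := G.comp (Polynomial.X + Polynomial.C (Polynomial.C w₀)) with hGs
  have hmap : Gs.map (Polynomial.evalRingHom 0) = E.comp (Polynomial.X + Polynomial.C w₀) := by
    rw [hGs, Polynomial.map_comp, hG0]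
    simp
  have hcoef : ∀ j, (Gs.coeff j).eval 0 = (E.comp (Polynomial.X + Polynomial.C w₀)).coeff j := by
    intro j
    rw [← hmap, Polynomial.coeff_map, Polynomial.coe_evalRingHom]
  have hmult : Polynomial.rootMultiplicity w₀ E = (E.comp (Polynomial.X + Polynomial.C w₀)).natTrailingDegree :=
    Polynomial.rootMultiplicity_eq_natTrailingDegree
  have hne : E.comp (Polynomial.X + Polynomial.C w₀) ≠ 0 := by
    rw [Ne, Polynomial.comp_eq_zero_iff, not_or]
    refine ⟨hE0, fun h => ?_⟩
    have := congrArg (Polynomial.coeff · 1) h.2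
    simp at this
  refine ⟨fun j hj => ?_, ?_⟩
  · rw [Polynomial.IsRoot, hcoef]
    exact Polynomial.coeff_eq_zero_of_lt_natTrailingDegree (by rwa [← hmult])
  · rw [Polynomial.IsRoot, hcoef, hmult]
    exact mt Polynomial.trailingCoeff_eq_zero.1 hne

/-! ## Part C. The totally degenerate edge -/

/-- **A root of full multiplicity makes the polynomial a pure power**: `E ≠ 0`,
`mult_{w₀} E = deg E = m` ⟹ `E.coeff (m - 1) ≠ 0` and `E.coeff 0 ≠ 0` when `w₀ ≠ 0`, `m ≥ 1`.
[folklore] -/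
theorem coeff_ne_zero_of_rootMultiplicity_eq_natDegree {E : ℂ[X]} {w₀ : ℂ} {m : ℕ} (hE0 : E ≠ 0)
    (hdeg : E.natDegree = m) (hm : 1 ≤ m) (hw₀ : w₀ ≠ 0) (hmult : Polynomial.rootMultiplicity w₀ E = m) :
    E.coeff (m - 1) ≠ 0 ∧ E.coeff 0 ≠ 0 := by
  obtain ⟨q, hq⟩ := Polynomial.pow_rootMultiplicity_dvd E w₀
  rw [hmult] at hq
  have hq0 : q ≠ 0 := fun h => hE0 (by rw [hq, h, mul_zero])
  have hqdeg : q.natDegree = 0 := by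
    have h := congrArg Polynomial.natDegree hq
    rw [Polynomial.natDegree_mul (pow_ne_zero _ (Polynomial.X_sub_C_ne_zero w₀)) hq0,
      Polynomial.natDegree_pow, Polynomial.natDegree_X_sub_C, mul_one, hdeg] at h
    omega
  obtain ⟨c, hc⟩ : ∃ c, q = Polynomial.C c := ⟨q.coeff 0, Polynomial.eq_C_of_natDegree_eq_zero hqdeg⟩
  have hc0 : c ≠ 0 := fun h => hq0 (by rw [hc, h, map_zero])
  have hE : E = Polynomial.C c * (Polynomial.X + Polynomial.C (-w₀)) ^ m := by
    rw [hq, hc, map_neg, ← sub_eq_add_neg]; ring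
  refine ⟨?_, ?_⟩
  · rw [hE, Polynomial.coeff_C_mul, Polynomial.coeff_X_add_C_pow, Nat.sub_sub_self hm, pow_one,
      Nat.choose_symm hm, Nat.choose_one_right]
    refine mul_ne_zero hc0 (mul_ne_zero (neg_ne_zero.2 hw₀) ?_)
    exact_mod_cast (show m ≠ 0 by omega)
  · rw [hE, Polynomial.coeff_C_mul, Polynomial.coeff_X_add_C_pow, Nat.sub_zero, Nat.choose_zero_right,
      Nat.cast_one, mul_one]
    exact mul_ne_zero hc0 (pow_ne_zero _ (neg_ne_zero.2 hw₀))

/-- **The totally degenerate edge has integer slope.**  In the setting of `exists_firstEdge`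
(`μ m ≤ k·ord₀ f_j + μ j` for nonzero rows, `k ≥ 1`), if the edge polynomial has
`E.coeff (m - 1) ≠ 0` and `E.coeff 0 ≠ 0`, then with `λ₀ := ord₀ f_{m-1}`: `μ = k λ₀`,
`ord₀ f₀ = λ₀ m`, `f₀ ≠ 0`, `λ₀ m ≤ ord₀ f_j + λ₀ j` for all nonzero rows, and the edge polynomial of
the datum `(1, λ₀)` is the same `E`. [folklore] -/
theorem degenerate_edge (F : ℂ[X][X]) {m k μ : ℕ} (hk : 1 ≤ k) (hm : 1 ≤ m)
    (hedge : ∀ j, F.coeff j ≠ 0 → μ * m ≤ k * Polynomial.rootMultiplicity 0 (F.coeff j) + μ * j)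
    (hEm1 : (∑ i ∈ (Finset.range (F.natDegree + 1)).filter (fun i => F.coeff i ≠ 0 ∧
        k * Polynomial.rootMultiplicity 0 (F.coeff i) + μ * i = μ * m),
        Polynomial.C ((F.coeff i /ₘ (Polynomial.X - Polynomial.C 0) ^
          Polynomial.rootMultiplicity 0 (F.coeff i)).eval 0) * Polynomial.X ^ i).coeff (m - 1) ≠ 0)
    (hE0c : (∑ i ∈ (Finset.range (F.natDegree + 1)).filter (fun i => F.coeff i ≠ 0 ∧
        k * Polynomial.rootMultiplicity 0 (F.coeff i) + μ * i = μ * m),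
        Polynomial.C ((F.coeff i /ₘ (Polynomial.X - Polynomial.C 0) ^
          Polynomial.rootMultiplicity 0 (F.coeff i)).eval 0) * Polynomial.X ^ i).coeff 0 ≠ 0) :
    let lam := Polynomial.rootMultiplicity 0 (F.coeff (m - 1))
    μ = k * lam ∧ F.coeff 0 ≠ 0 ∧ Polynomial.rootMultiplicity 0 (F.coeff 0) = lam * m ∧
    (∀ j, F.coeff j ≠ 0 → lam * m ≤ 1 * Polynomial.rootMultiplicity 0 (F.coeff j) + lam * j) ∧
    (∑ i ∈ (Finset.range (F.natDegree + 1)).filter (fun i => F.coeff i ≠ 0 ∧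
        1 * Polynomial.rootMultiplicity 0 (F.coeff i) + lam * i = lam * m),
        Polynomial.C ((F.coeff i /ₘ (Polynomial.X - Polynomial.C 0) ^
          Polynomial.rootMultiplicity 0 (F.coeff i)).eval 0) * Polynomial.X ^ i) =
    (∑ i ∈ (Finset.range (F.natDegree + 1)).filter (fun i => F.coeff i ≠ 0 ∧
        k * Polynomial.rootMultiplicity 0 (F.coeff i) + μ * i = μ * m),
        Polynomial.C ((F.coeff i /ₘ (Polynomial.X - Polynomial.C 0) ^
          Polynomial.rootMultiplicity 0 (F.coeff i)).eval 0) * Polynomial.X ^ i) := by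
  classical
  intro lam
  rw [firstEdge_coeff] at hEm1 hE0c
  split_ifs at hEm1 with h1
  swap
  · exact absurd rfl hEm1
  split_ifs at hE0c with h0
  swap
  · exact absurd rfl hE0c
  obtain ⟨-, hf1, he1⟩ := h1
  obtain ⟨-, hf0, he0⟩ := h0
  -- `μ = k λ`
  have hμ : μ = k * lam := by
    have : k * lam + μ * (m - 1) = μ * m := he1
    have e : μ * m = μ * (m - 1) + μ := by
      obtain ⟨m', rfl⟩ : ∃ m', m = m' + 1 := ⟨m - 1, by omega⟩
      simp [Nat.mul_succ]
    omega
  have hμm : μ * m = k * (lam * m) := by rw [hμ]; ring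
  -- `ord₀ f₀ = λ m`
  have ho0 : Polynomial.rootMultiplicity 0 (F.coeff 0) = lam * m := by
    have : k * Polynomial.rootMultiplicity 0 (F.coeff 0) + μ * 0 = μ * m := he0
    rw [mul_zero, add_zero, hμm] at this
    exact Nat.eq_of_mul_eq_mul_left (by omega) this
  refine ⟨hμ, hf0, ho0, fun j hj => ?_, ?_⟩
  · have h := hedge j hj
    rw [one_mul]
    rw [hμ] at h
    have h' : k * (lam * m) ≤ k * (Polynomial.rootMultiplicity 0 (F.coeff j) + lam * j) := by
      calc k * (lam * m) = k * lam * m := by ring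
        _ ≤ k * Polynomial.rootMultiplicity 0 (F.coeff j) + k * lam * j := h
        _ = k * (Polynomial.rootMultiplicity 0 (F.coeff j) + lam * j) := by ring
    exact Nat.le_of_mul_le_mul_left h' (by omega)
  · refine Finset.sum_congr (Finset.filter_congr fun i _ => ?_) fun _ _ => rfl
    refine and_congr Iff.rfl ⟨fun h => ?_, fun h => ?_⟩
    · rw [one_mul] at h
      rw [hμ]
      calc k * Polynomial.rootMultiplicity 0 (F.coeff i) + k * lam * i
          = k * (Polynomial.rootMultiplicity 0 (F.coeff i) + lam * i) := by ring
        _ = k * (lam * m) := by rw [h]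
        _ = k * lam * m := by ring
    · rw [one_mul]
      rw [hμ] at h
      have h' : k * (Polynomial.rootMultiplicity 0 (F.coeff i) + lam * i) = k * (lam * m) := by
        calc k * (Polynomial.rootMultiplicity 0 (F.coeff i) + lam * i)
            = k * Polynomial.rootMultiplicity 0 (F.coeff i) + k * lam * i := by ring
          _ = k * lam * m := h
          _ = k * (lam * m) := by ring
      exact Nat.eq_of_mul_eq_mul_left (by omega) h'

/-! ## Part D. The translation `y ↦ y + w₀ x^λ` -/

/-- **Translation facts.**  For `F₁(x, y) = F(x, y + w₀ x^λ)` (`λ ≥ 1`): the rows of `F₁` and `F`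
agree at `x = 0`, `F₁(x, y) = F(x, y + w₀ x^λ)` pointwise, and `F₁(t, 0) = F(t, w₀ t^λ)`. [folklore] -/
theorem translate_facts (F : ℂ[X][X]) (w₀ : ℂ) {lam : ℕ} (hlam : 1 ≤ lam) :
    let F₁ := F.comp (Polynomial.X + Polynomial.C (Polynomial.C w₀ * Polynomial.X ^ lam))
    (∀ j, (F₁.coeff j).eval 0 = (F.coeff j).eval 0) ∧
    (∀ x y : ℂ, (F₁.map (Polynomial.evalRingHom x)).eval y =
      (F.map (Polynomial.evalRingHom x)).eval (y + w₀ * x ^ lam)) ∧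
    (∀ t : ℂ, (F₁.coeff 0).eval t = (F.map (Polynomial.evalRingHom t)).eval (w₀ * t ^ lam)) := by
  intro F₁
  have hev : ∀ x y : ℂ, (F₁.map (Polynomial.evalRingHom x)).eval y =
      (F.map (Polynomial.evalRingHom x)).eval (y + w₀ * x ^ lam) := by
    intro x y
    simp only [F₁]
    rw [evalPP_comp_X_add_C]
    simp
  refine ⟨fun j => ?_, hev, fun t => ?_⟩
  · have hmap : F₁.map (Polynomial.evalRingHom 0) = F.map (Polynomial.evalRingHom 0) := by
      simp only [F₁]
      rw [Polynomial.map_comp]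
      simp [zero_pow (by omega : lam ≠ 0)]
    have h := congrArg (Polynomial.coeff · j) hmap
    simp only [Polynomial.coeff_map, Polynomial.coe_evalRingHom] at h
    exact h
  · have h1 : (F₁.coeff 0).eval t = (F₁.map (Polynomial.evalRingHom t)).coeff 0 := by
      rw [Polynomial.coeff_map, Polynomial.coe_evalRingHom]
    rw [h1, Polynomial.coeff_zero_eq_eval_zero, hev, zero_add]

end Summit.Schanuel.Schanuel.Theorems
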